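import Literature.Geometry.Riemannian.GeodesicFlowSmooth
import Literature.Geometry.Riemannian.ExponentialMapSmooth
import Literature.Geometry.Lorentzian.LeviCivitaAnalytic
import Literature.Analysis.ODE.AnalyticDependence
import HarnessLib

/-!
# The geodesic flow and the exponential map of a real-analytic connection are real-analytic

Support file of the programme towards the named fact
`Literature.Geometry.Riemannian.buchner1977_cutLocus_triangulable` (`CutLocus.lean`; M. A. Buchner,
*Simplicial structure of the real analytic cut locus*, Proc. AMS 64 (1977) 118–121). Buchner,
p. 119: "Since `M` is analytic the geodesics depend analytically on their initial conditions", the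
input that makes Milnor's broken-geodesic approximation `Ω(t₀, …, t_k)^s ⊂ M × ⋯ × M` an ANALYTIC
manifold with analytic energy function. In Lee's formulation (2018, Thm. 4.27 / Prop. 5.19, there
for `C^∞`): the geodesic flow of a `C^ω` connection on a `C^ω` manifold is `C^ω`, hence so is the
exponential map on its (open) domain.

The tree proves the `C^k` statements for `k : ℕ∞` (`GeodesicFlowSmooth.lean`,
`ExpMapGlobalSmooth.lean`, on a `C^∞` manifold, from Mathlib's class
`ContMDiffCovariantDerivative cov k` and the `C^k` flow theorem of `Analysis/ODE/FlowDomain.lean`).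
This file re-runs those proofs at the exponent `ω` on a `C^ω` manifold, with two substitutions:
the Christoffel data are read WITHOUT a bump function (the coordinate frame is analytic on the whole
chart domain, and the hypothesis is the sheaf-theoretic `cov.IsLocallyContMDiff ω` — Mathlib's
`ContMDiffCovariantDerivativeOn E ω` on every open set — which the Levi-Civita connection of a
`C^ω` metric satisfies, `isLocallyContMDiff_leviCivita_omega` of `LeviCivitaAnalytic.lean`), and
the local flow is the `C^ω` flow of `Analysis/ODE/AnalyticDependence.lean`
(`exists_contDiffOn_localFlow` at `n = ω`, Cauchy–Kovalevskaya-free: implicit function theorem on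
`C([0,1], E)`, Lang 1995, Ch. IV §1 / Robbin).

* `exists_christoffelChart_analytic` — analytic Christoffel data on the chart domain;
* `contDiffOn_geodesicField_omega` — the first-order geodesic system is `C^ω`;
* `exists_nhds_contMDiffOn_geodesicFlow_analytic` — the geodesic flow `(p, t) ↦ (γ_p(t), γ_p'(t))`
  is `C^ω` near every point of `TM` for short times (Lee Thm. 4.27, local part);
* `exists_nhds_contMDiffOn_geodesicFlow_of_subset_analytic` — and along whole compact orbit
  segments (Lang IV §1, Thm. 1.16: compose time-`T/N` maps);
* `contMDiffOn_expMap_totalSpace_analytic`, `contMDiffOn_expMap_analytic`,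
  `contMDiff_expMap_of_isGeodesicallyComplete_analytic` — `exp` is `C^ω` on its domain
  (Lee Prop. 5.19 (a), analytic case);
* `contMDiff_riemannianExpMap_omega` — for a `C^ω` metric with complete Levi-Civita connection,
  `exp_p : T_pM → M` is `C^ω` (Buchner 1977, p. 119).

No definitions, no named facts (D-0026).

## References

* J. M. Lee, *Introduction to Riemannian Manifolds*, 2nd ed. (2018), Thm. 4.27, Prop. 5.19.
  [LeeRiemannianManifolds2018]
* S. Lang, *Differential and Riemannian Manifolds* (1995), Ch. IV §1, Thms. 1.14, 1.16. [Lang1995]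
* M. A. Buchner, Proc. AMS 64 (1977), p. 119. [Buchner1977Simplicial]
-/

noncomputable section

open Bundle Set Filter Metric
open scoped Manifold ContDiff Topology

namespace Literature.Geometry.Riemannian

open Literature.Geometry.Lorentzian

variable {E : Type*} [NormedAddCommGroup E] [NormedSpace ℝ E] {H : Type*} [TopologicalSpace H]
  {I : ModelWithCorners ℝ E H} {M : Type*} [TopologicalSpace M] [ChartedSpace H M]
  [IsManifold I ω M] [FiniteDimensional ℝ E]
  {cov : CovariantDerivative I E (TangentSpace I : M → Type _)}

/-! ### Analytic Christoffel data -/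

omit [FiniteDimensional ℝ E] in
/-- **Analytic Christoffel data in a chart.** For a locally `C^ω` connection (`cov.IsLocallyContMDiff ω`)
on a `C^ω` manifold and a point `x₁`, on the chart domain `N` of `x₁` there are maps
`Ĉᵢ : M → (E →L[ℝ] E)`, real-analytic on `N`, reading `w ↦ ∇_w sᵢ` in the trivialisation at `x₁`
for the coordinate frame `sᵢ` of the chart at `x₁`, at every point of `N`. Same construction as the
tree's `exists_christoffelChart_contMDiffOn` (O'Neill 1983, Ch. 3, Lemma 22 / Lee 2018, Prop. 4.7),
except that no bump function is used: the frame `sᵢ` is analytic on `N` and the sheaf hypothesis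
applies to it on `N` directly; the regularity is read through the trivialisation of `Hom(TM, TM)`
at `x₁` (`Trivialization.contMDiffOn_section_iff`). [cite: ONeill1983, Ch. 3, Lemma 22] -/
theorem exists_christoffelChart_analytic (hcov : cov.IsLocallyContMDiff ω)
    {ι : Type*} [Fintype ι] (b : Module.Basis ι ℝ E) (x₁ : M) :
    ∃ (N : Set M) (Ĉ : ι → M → (E →L[ℝ] E)), IsOpen N ∧ x₁ ∈ N ∧ N ⊆ (chartAt H x₁).source ∧
      (∀ y ∈ N, ∀ (i) (w : TangentSpace I y),
        Ĉ i y ((trivializationAt E (TangentSpace I) x₁).continuousLinearMapAt ℝ y w) =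
          (trivializationAt E (TangentSpace I) x₁
            ⟨y, cov ((trivializationAt E (TangentSpace I) x₁).localFrame b i) y w⟩).2) ∧
      ∀ i, ContMDiffOn I 𝓘(ℝ, E →L[ℝ] E) ω (Ĉ i) N := by
  set e₁ := trivializationAt E (TangentSpace I : M → Type _) x₁ with he₁_def
  set N : Set M := (chartAt H x₁).source with hN_def
  have hN : IsOpen N := (chartAt H x₁).open_source
  have hx₁ : x₁ ∈ N := mem_chart_source H x₁
  have hNb : ∀ y ∈ N, y ∈ e₁.baseSet := fun y hy ↦ by
    rw [he₁_def, TangentBundle.trivializationAt_baseSet]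
    exact hy
  have hbN : e₁.baseSet ⊆ N := fun y hy ↦ by
    rw [he₁_def, TangentBundle.trivializationAt_baseSet] at hy
    exact hy
  have hσ : ∀ i, CMDiff[N] ω (T% (e₁.localFrame b i)) := fun i ↦
    (e₁.contMDiffOn_localFrame_baseSet ω b i).mono hNb
  refine ⟨N, fun i y ↦ ContinuousLinearMap.inCoordinates E (TangentSpace I : M → Type _) E
    (TangentSpace I : M → Type _) x₁ y x₁ y (cov (e₁.localFrame b i) y), hN, hx₁, subset_rfl,
    ?_, ?_⟩
  · intro y hy i w
    have hye : y ∈ e₁.baseSet := hNb y hy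
    beta_reduce
    rw [ContinuousLinearMap.inCoordinates_eq hye hye]
    simp only [ContinuousLinearMap.coe_comp, Function.comp_apply, ContinuousLinearEquiv.coe_coe,
      Trivialization.symm_continuousLinearEquivAt_eq, Trivialization.coe_continuousLinearEquivAt_eq]
    rw [Trivialization.symmL_continuousLinearMapAt _ hye,
      Trivialization.continuousLinearMapAt_apply_of_mem ℝ _ hye]
  · intro i
    have htop : (ω : ℕ∞ω) + 1 = ω := by simp
    have hσ' : CMDiff[N] ((ω : ℕ∞ω) + 1) (T% (e₁.localFrame b i)) := by
      rw [htop]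
      exact hσ i
    have h1 : ContMDiffOn I (I.prod 𝓘(ℝ, E →L[ℝ] E)) ω
        (fun y ↦ (⟨y, cov (e₁.localFrame b i) y⟩ :
          TotalSpace (E →L[ℝ] E) (fun y : M ↦ TangentSpace I y →L[ℝ] TangentSpace I y))) N :=
      (hcov N hN).contMDiff hσ'
    have hNb' : N ⊆ (trivializationAt (E →L[ℝ] E)
        (fun y : M ↦ TangentSpace I y →L[ℝ] TangentSpace I y) x₁).baseSet := by
      intro y hy
      rw [hom_trivializationAt_baseSet]
      exact ⟨hNb y hy, hNb y hy⟩
    exact ((trivializationAt (E →L[ℝ] E)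
      (fun y : M ↦ TangentSpace I y →L[ℝ] TangentSpace I y) x₁).contMDiffOn_section_iff
        hN hNb').1 h1

/-! ### The first-order geodesic system is `C^ω` -/

/-- **The geodesic system is `C^ω` on (chart ball) `× E`** for analytic Christoffel data: with
`Ĉᵢ` analytic on `N` and a chart ball `O` (`φ⁻¹ O ⊆ N`, `range I` a neighbourhood of each point of
`O`), the field `F(u, w) = (w, -∑ᵢ wⁱ Ĉᵢ(φ⁻¹ u) w)` of the first-order geodesic system
(O'Neill 1983, Ch. 3, Cor. 21) is `C^ω` on `O × E` (the tree's `contDiffOn_geodesicField` at the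
exponent `ω`, the chart inverse of a `C^ω` manifold being `C^ω`). [cite: ONeill1983, Ch. 3, Cor. 21] -/
theorem contDiffOn_geodesicField_omega {ι : Type*} [Fintype ι] (b : Module.Basis ι ℝ E)
    {x₁ : M} {N : Set M} (hN : IsOpen N) {Ĉ : ι → M → (E →L[ℝ] E)}
    (hĈs : ∀ i, ContMDiffOn I 𝓘(ℝ, E →L[ℝ] E) ω (Ĉ i) N)
    {O : Set E} (hOt : O ⊆ (extChartAt I x₁).target)
    (hON : ∀ z ∈ O, (extChartAt I x₁).symm z ∈ N) (hOr : ∀ z ∈ O, range I ∈ 𝓝 z) :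
    ContDiffOn ℝ ω (fun pq : E × E ↦ ((pq.2,
      -∑ i, b.repr pq.2 i • Ĉ i ((extChartAt I x₁).symm pq.1) pq.2) : E × E)) (O ×ˢ univ) := by
  set φ := extChartAt I x₁ with hφ_def
  -- `Ĉ i ∘ φ⁻¹` is `C^ω` at every point of `O`
  have h1 : ∀ i, ∀ z ∈ O, ContDiffAt ℝ ω (Ĉ i ∘ φ.symm) z := by
    intro i z hz
    have h2 : ContMDiffWithinAt 𝓘(ℝ, E) 𝓘(ℝ, E →L[ℝ] E) ω (Ĉ i ∘ φ.symm) (range I) z := by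
      have h3 : ContMDiffWithinAt 𝓘(ℝ, E) I ω φ.symm (range I) z :=
        contMDiffWithinAt_extChartAt_symm_range (I := I) (n := ω) x₁ (hOt hz)
      have h4 : ContMDiffAt I 𝓘(ℝ, E →L[ℝ] E) ω (Ĉ i) (φ.symm z) :=
        (hĈs i _ (hON z hz)).contMDiffAt (hN.mem_nhds (hON z hz))
      exact h4.comp_contMDiffWithinAt _ h3
    exact (contMDiffWithinAt_iff_contDiffWithinAt.mp h2).contDiffAt (hOr z hz)
  rintro pq ⟨hz, -⟩
  have hG : ContDiffAt ℝ ω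
      (fun pq : E × E ↦ -∑ i, b.repr pq.2 i • Ĉ i (φ.symm pq.1) pq.2) pq := by
    have hC : ∀ i, ContDiffAt ℝ ω (fun pq : E × E ↦ Ĉ i (φ.symm pq.1)) pq := fun i ↦
      ContDiffAt.comp (f := Prod.fst) pq (h1 i pq.1 hz) contDiffAt_fst
    have h4 : ∀ i, ContDiffAt ℝ ω (fun pq : E × E ↦ b.repr pq.2 i) pq := fun i ↦
      (((b.coord i).toContinuousLinearMap).contDiff.comp contDiff_snd).contDiffAt
    exact (ContDiffAt.sum fun i _ ↦ (h4 i).smul ((hC i).clm_apply contDiffAt_snd)).neg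
  exact (contDiffAt_snd.prodMk hG).contDiffWithinAt

/-! ### The local `C^ω` geodesic flow -/

/-- **The geodesic flow of an analytic connection is `C^ω` near every point of `TM`, for short
times** (Lee 2018, Thm. 4.27 / Prop. 5.19, local part, analytic case; Buchner 1977, p. 119: "the
geodesics depend analytically on their initial conditions"). For a covariant derivative `cov` on `TM`
of a `C^ω` manifold without boundary which is locally `C^ω` (and `C¹`, the class under which the
tree's maximal geodesics `γ_p` are defined) and `p₀ ∈ TM`, there are an open neighbourhood `𝒰` of
`p₀` and `ε > 0` with `(-ε, ε) ⊆ dom γ_p` for `p ∈ 𝒰` and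
`(p, t) ↦ (γ_p(t), γ_p'(t))` of class `C^ω` on `𝒰 × (-ε, ε)`. Proof: that of the tree's
`exists_nhds_contMDiffOn_geodesicFlow`, with the analytic geodesic system
(`contDiffOn_geodesicField_omega`) and the `C^ω` local flow
`Literature.Analysis.ODE.exists_contDiffOn_localFlow` (Lang 1995, IV §1, Thm. 1.14 at `p = ω`).
[cite: LeeRiemannianManifolds2018, Thm. 4.27 and Prop. 5.19] -/
theorem exists_nhds_contMDiffOn_geodesicFlow_analytic [CompleteSpace E] [T2Space M]
    [BoundarylessManifold I M] [CovariantDerivative.ContMDiffCovariantDerivative cov 1]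
    (hcov : cov.IsLocallyContMDiff ω) (p₀ : TangentBundle I M) :
    ∃ 𝒰 : Set (TangentBundle I M), IsOpen 𝒰 ∧ p₀ ∈ 𝒰 ∧ ∃ ε > (0 : ℝ),
      (∀ p ∈ 𝒰, Ioo (-ε) ε ⊆ maximalGeodesicDomain cov p.proj p.2) ∧
      ContMDiffOn (I.tangent.prod 𝓘(ℝ, ℝ)) I.tangent ω
        (fun q : TangentBundle I M × ℝ ↦ tangentLift I (maximalGeodesic cov q.1.proj q.1.2) q.2)
        (𝒰 ×ˢ Ioo (-ε) ε) := by
  set x₁ := p₀.proj with hx₁_def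
  set b := Module.finBasis ℝ E with hb_def
  obtain ⟨N, Ĉ, hN, hxN, hNs, hĈ, hĈs⟩ := exists_christoffelChart_analytic (cov := cov) hcov b x₁
  set φ := extChartAt I x₁ with hφ_def
  set e₁ := trivializationAt E (TangentSpace I : M → Type _) x₁ with he₁_def
  obtain ⟨O, hO, hxO, hOt, hON, hOr⟩ :=
    exists_chartBall (I := I) (BoundarylessManifold.isInteriorPoint (x := x₁)) hN hxN
  -- the first-order system and its `C^ω` local flow around `z₀`
  set F : E × E → E × E := fun pq ↦
    (pq.2, -∑ i, b.repr pq.2 i • Ĉ i (φ.symm pq.1) pq.2) with hF_def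
  have hF : ContDiffOn ℝ ω F (O ×ˢ univ) := contDiffOn_geodesicField_omega b hN hĈs hOt hON hOr
  set z₀ : E × E := (φ x₁, (e₁ p₀).2) with hz₀_def
  have hz₀ : z₀ ∈ O ×ˢ (univ : Set E) := ⟨hxO, mem_univ _⟩
  obtain ⟨fl, r, hr, ε, hε, hfl0, hfld, hflU, hfls⟩ :=
    Literature.Analysis.ODE.exists_contDiffOn_localFlow (hO.prod isOpen_univ) hF le_top hz₀
  -- the chart map `Z` of `TM` at `p₀` and the neighbourhood `𝒰`
  set Z : TangentBundle I M → E × E := fun p ↦ (φ p.proj, (e₁ p).2) with hZ_def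
  have hp₀ : p₀ ∈ e₁.source := by
    rw [e₁.mem_source, he₁_def, TangentBundle.trivializationAt_baseSet]
    exact mem_chart_source H p₀.proj
  have hZs : ContMDiffOn I.tangent 𝓘(ℝ, E × E) ω Z e₁.source := by
    refine ContMDiffOn.prodMk_space ?_ ?_
    · refine (contMDiffOn_extChartAt (I := I) (n := ω) (x := x₁)).comp
        (Bundle.contMDiff_proj (TangentSpace I : M → Type _)).contMDiffOn ?_
      intro p hp
      simpa [he₁_def] using e₁.mem_source.1 hp
    · exact contMDiff_snd.comp_contMDiffOn e₁.contMDiffOn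
  have hZc : ContinuousOn Z e₁.source := hZs.continuousOn
  have hZ₀ : Z p₀ = z₀ := rfl
  set 𝒰 : Set (TangentBundle I M) := e₁.source ∩ Z ⁻¹' ball z₀ r with h𝒰_def
  have h𝒰o : IsOpen 𝒰 := hZc.isOpen_inter_preimage e₁.open_source isOpen_ball
  have h𝒰 : p₀ ∈ 𝒰 := ⟨hp₀, by rw [mem_preimage, hZ₀]; exact mem_ball_self hr⟩
  -- for `p ∈ 𝒰`, the flow line through `Z p` is a geodesic with initial data `p`
  have h0ε : (0 : ℝ) ∈ Ioo (-ε) ε := ⟨by linarith, hε⟩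
  have key : ∀ p ∈ 𝒰,
      IsGeodesicOn cov (fun t ↦ φ.symm (fl (Z p) t).1) (Ioo (-ε) ε) ∧
      (∀ t ∈ Ioo (-ε) ε, (e₁ (tangentLift I (fun t ↦ φ.symm (fl (Z p) t).1) t)).2 =
        (fl (Z p) t).2) ∧
      (fun t ↦ φ.symm (fl (Z p) t).1) 0 = p.proj ∧
      velocity I (fun t ↦ φ.symm (fl (Z p) t).1) 0 = p.2 := by
    rintro ⟨x, v⟩ hp
    set p : TangentBundle I M := ⟨x, v⟩ with hp_def
    have hps : x ∈ (chartAt H x₁).source := by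
      simpa [he₁_def] using e₁.mem_source.1 hp.1
    obtain ⟨hgeo, hU⟩ := isGeodesicOn_of_chartSolution (cov := cov) b hNs Ĉ hĈ hO hOt hON hOr
      isOpen_Ioo (fun t ht ↦ hfld _ hp.2 t ht) (fun t ht ↦ (hflU _ hp.2 t ht).1)
    have hf0 : fl (Z p) 0 = Z p := hfl0 _ hp.2
    have hγ0 : φ.symm (fl (Z p) 0).1 = x := by
      rw [hf0]
      exact φ.left_inv (by rwa [hφ_def, extChartAt_source])
    have hlift : tangentLift I (fun t ↦ φ.symm (fl (Z p) t).1) 0 = p := by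
      refine eq_of_trivializationAt_snd_eq (x₁ := x₁)
        (by simpa only [tangentLift_proj] using hγ0 ▸ hps) hγ0 ?_
      rw [hU 0 h0ε, hf0]
    refine ⟨hgeo, hU, hγ0, ?_⟩
    exact eq_of_heq (TotalSpace.mk.inj hlift).2
  refine ⟨𝒰, h𝒰o, h𝒰, ε, hε, fun p hp ↦ ?_, ?_⟩
  · obtain ⟨hgeo, -, hγ0, hv0⟩ := key p hp
    exact (subset_maximalGeodesicDomain_of_isGeodesicOn isOpen_Ioo ordConnected_Ioo h0ε hgeo
      hγ0 hv0).1
  -- regularity: read the flow in the trivialisation `e₁`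
  set Ψ : TangentBundle I M × ℝ → TangentBundle I M := fun q ↦
    tangentLift I (maximalGeodesic cov q.1.proj q.1.2) q.2 with hΨ_def
  set S : Set (TangentBundle I M × ℝ) := 𝒰 ×ˢ Ioo (-ε) ε with hS_def
  have hΨeq : ∀ q ∈ S, Ψ q = tangentLift I (fun t ↦ φ.symm (fl (Z q.1) t).1) q.2 := by
    rintro ⟨p, t⟩ ⟨hp, ht⟩
    obtain ⟨hgeo, -, hγ0, hv0⟩ := key p hp
    exact (tangentLift_eqOn_maximalGeodesic_of_isGeodesicOn isOpen_Ioo ordConnected_Ioo h0ε hgeo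
      hγ0 hv0 ht).symm
  have hbase : ∀ q ∈ S, (Ψ q).proj = φ.symm (fl (Z q.1) q.2).1 := fun q hq ↦ by
    rw [hΨeq q hq]; rfl
  have hfib : ∀ q ∈ S, (e₁ (Ψ q)).2 = (fl (Z q.1) q.2).2 := by
    rintro ⟨p, t⟩ ⟨hp, ht⟩
    obtain ⟨-, hU, -, -⟩ := key p hp
    rw [hΨeq (p, t) ⟨hp, ht⟩]
    exact hU t ht
  have hsrc : ∀ q ∈ S, (Ψ q).proj ∈ (chartAt H x₁).source := fun q hq ↦ by
    rw [hbase q hq, ← extChartAt_source I]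
    exact φ.map_target (hOt (hflU _ hq.1.2 _ hq.2).1)
  have hmaps : MapsTo Ψ S e₁.source := fun q hq ↦
    e₁.mem_source.2 (by simpa [he₁_def] using hsrc q hq)
  -- the composite `q ↦ fl (Z q.1) q.2` is `C^ω` on `S`
  have hB : ContMDiffOn (I.tangent.prod 𝓘(ℝ, ℝ)) 𝓘(ℝ, (E × E) × ℝ) ω
      (fun q : TangentBundle I M × ℝ ↦ (Z q.1, q.2)) S := by
    refine ContMDiffOn.prodMk_space ?_ contMDiffOn_snd
    exact (hZs.comp contMDiffOn_fst fun q hq ↦ hq.1.1)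
  have hC : ContMDiffOn (I.tangent.prod 𝓘(ℝ, ℝ)) 𝓘(ℝ, E × E) ω
      (fun q : TangentBundle I M × ℝ ↦ fl (Z q.1) q.2) S := by
    have hfl : ContMDiffOn 𝓘(ℝ, (E × E) × ℝ) 𝓘(ℝ, E × E) ω
        (fun zt : (E × E) × ℝ ↦ fl zt.1 zt.2) (ball z₀ r ×ˢ Ioo (-ε) ε) :=
      contMDiffOn_iff_contDiffOn.2 hfls
    exact hfl.comp hB fun q hq ↦ ⟨hq.1.2, hq.2⟩
  have hC1 : ContMDiffOn (I.tangent.prod 𝓘(ℝ, ℝ)) 𝓘(ℝ, E) ω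
      (fun q : TangentBundle I M × ℝ ↦ (fl (Z q.1) q.2).1) S :=
    (contDiff_fst (𝕜 := ℝ) (E := E) (F := E)).contMDiff.comp_contMDiffOn hC
  have hC2 : ContMDiffOn (I.tangent.prod 𝓘(ℝ, ℝ)) 𝓘(ℝ, E) ω
      (fun q : TangentBundle I M × ℝ ↦ (fl (Z q.1) q.2).2) S :=
    (contDiff_snd (𝕜 := ℝ) (E := E) (F := E)).contMDiff.comp_contMDiffOn hC
  rw [e₁.contMDiffOn_iff hmaps]
  constructor
  · have h1 : ContMDiffOn (I.tangent.prod 𝓘(ℝ, ℝ)) I ω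
        (fun q : TangentBundle I M × ℝ ↦ φ.symm (fl (Z q.1) q.2).1) S :=
      ((contMDiffOn_extChartAt_symm (I := I) (n := ω) x₁).comp hC1
        fun q hq ↦ hOt (hflU _ hq.1.2 _ hq.2).1)
    exact h1.congr hbase
  · exact hC2.congr hfib

/-! ### Globalisation along compact orbit segments -/

section Global

variable [CompleteSpace E] [T2Space M] [BoundarylessManifold I M]
  [CovariantDerivative.ContMDiffCovariantDerivative cov 1]

/-- **The analytic geodesic flow is `C^ω` along whole orbit segments, and the domains are lower
semicontinuous** (Lee 2018, Thm. 4.27 with the fundamental theorem on flows, Prop. 5.19 (c);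
Lang 1995, Ch. IV §1, Thm. 1.16 — cover the compact orbit segment by finitely many local flows,
write the time-`T` map as an `N`-fold composite of time-`T/N` maps; the tree's
`exists_nhds_contMDiffOn_geodesicFlow_of_subset` at the exponent `ω`). If `[0, T] ⊆ dom γ_{p₀}` then
on a neighbourhood `𝒱` of `p₀` in `TM` all `γ_p` are defined on `[0, T]` and
`p ↦ (γ_p(T), γ_p'(T))` is `C^ω`. [cite: LeeRiemannianManifolds2018, Thm. 4.27 and Prop. 5.19 (c)] -/
theorem exists_nhds_contMDiffOn_geodesicFlow_of_subset_analytic (hcov : cov.IsLocallyContMDiff ω)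
    (p₀ : TangentBundle I M)
    {T : ℝ} (hT : 0 ≤ T) (hTdom : Icc 0 T ⊆ maximalGeodesicDomain cov p₀.proj p₀.2) :
    ∃ 𝒱 : Set (TangentBundle I M), IsOpen 𝒱 ∧ p₀ ∈ 𝒱 ∧
      (∀ p ∈ 𝒱, Icc 0 T ⊆ maximalGeodesicDomain cov p.proj p.2) ∧
      ContMDiffOn I.tangent I.tangent ω
        (fun p : TangentBundle I M ↦ tangentLift I (maximalGeodesic cov p.proj p.2) T) 𝒱 := by
  classical
  -- local flows everywhere
  choose 𝒰 h𝒰o hmem ε hε hdom hsmooth using fun q : TangentBundle I M ↦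
    exists_nhds_contMDiffOn_geodesicFlow_analytic (cov := cov) hcov q
  -- the compact orbit segment and a finite subcover
  set Φ₀ : ℝ → TangentBundle I M := tangentLift I (maximalGeodesic cov p₀.proj p₀.2) with hΦ₀
  have hK : IsCompact (Φ₀ '' Icc 0 T) :=
    isCompact_Icc.image_of_continuousOn
      ((continuousOn_tangentLift_maximalGeodesic _ _).mono hTdom)
  obtain ⟨t, ht⟩ := hK.elim_finite_subcover 𝒰 (fun q ↦ h𝒰o q)
    (fun q _ ↦ mem_iUnion.2 ⟨q, hmem q⟩)
  have htne : t.Nonempty := by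
    have h0 : Φ₀ 0 ∈ Φ₀ '' Icc 0 T := mem_image_of_mem _ ⟨le_rfl, hT⟩
    obtain ⟨q, hq, -⟩ := mem_iUnion₂.1 (ht h0)
    exact ⟨q, hq⟩
  set ε₀ : ℝ := t.inf' htne ε with hε₀
  have hε₀pos : 0 < ε₀ := (Finset.lt_inf'_iff htne).2 fun q _ ↦ hε q
  have hε₀le : ∀ q ∈ t, ε₀ ≤ ε q := fun q hq ↦ Finset.inf'_le ε hq
  -- the number of steps and the step `τ = T / N < ε₀`
  obtain ⟨N, hN⟩ := exists_nat_gt (T / ε₀)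
  have hNpos' : (0 : ℝ) < N := lt_of_le_of_lt (div_nonneg hT hε₀pos.le) hN
  have hNpos : 0 < N := by exact_mod_cast hNpos'
  set τ : ℝ := T / N with hτ
  have hτ0 : 0 ≤ τ := div_nonneg hT (Nat.cast_nonneg N)
  have hτε : τ < ε₀ := by
    rw [hτ, div_lt_iff₀ hNpos']
    calc T = (T / ε₀) * ε₀ := by field_simp
      _ < N * ε₀ := by gcongr
      _ = ε₀ * N := mul_comm _ _
  have hNτ : (N : ℝ) * τ = T := by
    rw [hτ]
    field_simp
  -- induction on the number of steps
  have step : ∀ j : ℕ, j ≤ N → ∃ 𝒱 : Set (TangentBundle I M), IsOpen 𝒱 ∧ p₀ ∈ 𝒱 ∧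
      (∀ p ∈ 𝒱, Icc 0 ((j : ℝ) * τ) ⊆ maximalGeodesicDomain cov p.proj p.2) ∧
      ContMDiffOn I.tangent I.tangent ω
        (fun p : TangentBundle I M ↦
          tangentLift I (maximalGeodesic cov p.proj p.2) ((j : ℝ) * τ)) 𝒱 := by
    intro j
    induction j with
    | zero =>
      intro _
      refine ⟨univ, isOpen_univ, mem_univ _, fun p _ s hs ↦ ?_, ?_⟩
      · have hs0 : s = 0 := le_antisymm (by simpa using hs.2) hs.1
        rw [hs0]
        exact (maximalGeodesic_spec' (cov := cov) p.proj p.2).2.1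
      · simp only [Nat.cast_zero, zero_mul]
        exact contMDiffOn_id.congr fun p _ ↦ tangentLift_maximalGeodesic_zero (cov := cov) p
    | succ j ih =>
      intro hj
      obtain ⟨𝒱, h𝒱o, hp𝒱, hdomj, hsmj⟩ := ih (Nat.le_of_succ_le hj)
      have hjτ0 : 0 ≤ (j : ℝ) * τ := mul_nonneg (Nat.cast_nonneg j) hτ0
      -- the point of the orbit at time `j τ` lies in one of the local flows
      have hjτT : (j : ℝ) * τ ∈ Icc 0 T := by
        refine ⟨hjτ0, ?_⟩
        calc (j : ℝ) * τ ≤ N * τ := by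
              gcongr
              exact_mod_cast Nat.le_of_succ_le hj
          _ = T := hNτ
      obtain ⟨q, hqt, hq⟩ := mem_iUnion₂.1 (ht (mem_image_of_mem Φ₀ hjτT))
      set Φj : TangentBundle I M → TangentBundle I M := fun p ↦
        tangentLift I (maximalGeodesic cov p.proj p.2) ((j : ℝ) * τ) with hΦj
      set 𝒱' : Set (TangentBundle I M) := 𝒱 ∩ Φj ⁻¹' 𝒰 q with h𝒱'
      have h𝒱'o : IsOpen 𝒱' := hsmj.continuousOn.isOpen_inter_preimage h𝒱o (h𝒰o q)
      have hp𝒱' : p₀ ∈ 𝒱' := ⟨hp𝒱, hq⟩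
      have hτq : τ ∈ Ioo (-(ε q)) (ε q) := ⟨by linarith [hε q], hτε.trans_le (hε₀le q hqt)⟩
      -- domains: `[0, (j+1)τ] ⊆ dom γ_p` for `p ∈ 𝒱'`
      have hdomj1 : ∀ p ∈ 𝒱', Icc 0 (((j + 1 : ℕ) : ℝ) * τ) ⊆
          maximalGeodesicDomain cov p.proj p.2 := by
        intro p hp s hs
        by_cases hsj : s ≤ j * τ
        · exact hdomj p hp.1 ⟨hs.1, hsj⟩
        · push Not at hsj
          have hjdom : (j : ℝ) * τ ∈ maximalGeodesicDomain cov p.proj p.2 :=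
            hdomj p hp.1 ⟨hjτ0, le_rfl⟩
          have hs' : s - j * τ ∈ Ioo (-(ε q)) (ε q) := by
            have h2 : s ≤ ((j + 1 : ℕ) : ℝ) * τ := hs.2
            push_cast at h2
            constructor
            · linarith [hε q]
            · linarith [hτq.2]
          have hmem' := hdom q (Φj p) hp.2 hs'
          have h3 := add_mem_maximalGeodesicDomain_of_translate (cov := cov) p.proj p.2 hjdom hmem'
          simpa using h3
      refine ⟨𝒱', h𝒱'o, hp𝒱', hdomj1, ?_⟩
      -- regularity: `Φ_{(j+1)τ} = Φ_τ ∘ Φ_{jτ}` on `𝒱'`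
      have hcomp : ContMDiffOn I.tangent I.tangent ω
          (fun p : TangentBundle I M ↦ tangentLift I
            (maximalGeodesic cov (Φj p).proj (Φj p).2) τ) 𝒱' := by
        have hinner : ContMDiffOn I.tangent (I.tangent.prod 𝓘(ℝ, ℝ)) ω
            (fun p : TangentBundle I M ↦ (Φj p, τ)) 𝒱' :=
          (hsmj.mono inter_subset_left).prodMk contMDiffOn_const
        exact (hsmooth q).comp hinner fun p hp ↦ ⟨hp.2, hτq⟩
      refine hcomp.congr fun p hp ↦ ?_
      have hjdom : (j : ℝ) * τ ∈ maximalGeodesicDomain cov p.proj p.2 :=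
        hdomj p hp.1 ⟨hjτ0, le_rfl⟩
      have h1 : τ + j * τ ∈ maximalGeodesicDomain cov p.proj p.2 := by
        refine hdomj1 p hp ⟨by positivity, ?_⟩
        push_cast
        linarith
      obtain ⟨-, hlift⟩ := maximalGeodesic_translate (cov := cov) p.proj p.2 hjdom h1
      have h2 : ((j + 1 : ℕ) : ℝ) * τ = τ + j * τ := by
        push_cast
        ring
      rw [h2]
      exact hlift.symm
  obtain ⟨𝒱, h𝒱o, hp𝒱, hdomN, hsmN⟩ := step N le_rfl
  rw [hNτ] at hdomN hsmN
  exact ⟨𝒱, h𝒱o, hp𝒱, hdomN, hsmN⟩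

/-! ### The exponential map of an analytic connection is analytic on its domain -/

/-- **`exp` is `C^ω` on `𝓔 ⊆ TM`** for a locally `C^ω` connection on a `C^ω` manifold (Lee 2018,
Prop. 5.19 (a), analytic case): `exp(p) = π(γ_p(1), γ_p'(1))`, the time-one map of the analytic
geodesic flow being `C^ω` near every point of `𝓔`
(`exists_nhds_contMDiffOn_geodesicFlow_of_subset_analytic`) and `π` analytic.
[cite: LeeRiemannianManifolds2018, Prop. 5.19 (a)] -/
theorem contMDiffOn_expMap_totalSpace_analytic (hcov : cov.IsLocallyContMDiff ω) :
    ContMDiffOn I.tangent I ω (fun p : TangentBundle I M ↦ expMap cov p.proj p.2)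
      {p : TangentBundle I M | (1 : ℝ) ∈ maximalGeodesicDomain cov p.proj p.2} := by
  intro p₀ hp₀
  obtain ⟨hmax, h0, -, -⟩ := maximalGeodesic_spec' (cov := cov) p₀.proj p₀.2
  have hI : Icc (0 : ℝ) 1 ⊆ maximalGeodesicDomain cov p₀.proj p₀.2 := hmax.2.1.out h0 hp₀
  obtain ⟨𝒱, h𝒱o, hp𝒱, hdom, hsm⟩ :=
    exists_nhds_contMDiffOn_geodesicFlow_of_subset_analytic (cov := cov) hcov p₀ zero_le_one hI
  have h1 : ContMDiffOn I.tangent I ω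
      (fun p : TangentBundle I M ↦ (tangentLift I (maximalGeodesic cov p.proj p.2) 1).proj) 𝒱 :=
    (Bundle.contMDiff_proj (TangentSpace I : M → Type _)).comp_contMDiffOn hsm
  have h2 : ContMDiffOn I.tangent I ω (fun p : TangentBundle I M ↦ expMap cov p.proj p.2) 𝒱 := by
    refine h1.congr fun p hp ↦ ?_
    rw [expMap_of_mem ⟨hasMaximalGeodesic (cov := cov) p.proj p.2,
      hdom p hp ⟨zero_le_one, le_rfl⟩⟩]
    rfl
  exact (h2.contMDiffAt (h𝒱o.mem_nhds hp𝒱)).contMDiffWithinAt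

omit [FiniteDimensional ℝ E] [CompleteSpace E] [T2Space M] [BoundarylessManifold I M]
  [CovariantDerivative.ContMDiffCovariantDerivative cov 1] in
/-- The inclusion of a fibre, `v ↦ (x, v) : T_xM → TM`, is `C^ω` on a `C^ω` manifold (`T_xM` read
as the model vector space `E`; the tree's `contMDiff_tangentTotalSpaceMk` at exponent `ω`).
[folklore] -/
theorem contMDiff_tangentTotalSpaceMk_omega (x : M) :
    ContMDiff 𝓘(ℝ, E) I.tangent ω (fun v : E ↦ (⟨x, v⟩ : TangentBundle I M)) := by
  intro v
  rw [ModelWithCorners.tangent, Bundle.contMDiffAt_totalSpace]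
  refine ⟨contMDiffAt_const, ?_⟩
  set e₁ := trivializationAt E (TangentSpace I : M → Type _) x with he₁
  have hx : x ∈ e₁.baseSet := by
    rw [he₁, TangentBundle.trivializationAt_baseSet]
    exact mem_chart_source H x
  set A : E →L[ℝ] E := e₁.continuousLinearMapAt ℝ x with hA
  have heq : (fun w : E ↦ (e₁ ⟨x, w⟩).2) = fun w : E ↦ A w := by
    funext w
    exact (Trivialization.continuousLinearMapAt_apply_of_mem ℝ e₁ hx w).symm
  show ContMDiffAt 𝓘(ℝ, E) 𝓘(ℝ, E) ω (fun w : E ↦ (e₁ ⟨x, w⟩).2) v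
  rw [heq]
  exact (contMDiff_iff_contDiff.2 A.contDiff).contMDiffAt

/-- **`exp_x` is `C^ω` on `𝓔_x`** for a locally `C^ω` connection on a `C^ω` manifold (Lee 2018,
Prop. 5.19 (a) restricted to a fibre, analytic case: `exp_x = exp ∘ (v ↦ (x, v))`; `T_x M` read as
the model space `E`). [cite: LeeRiemannianManifolds2018, Prop. 5.19 (a)] -/
theorem contMDiffOn_expMap_analytic (hcov : cov.IsLocallyContMDiff ω) (x : M) :
    ContMDiffOn 𝓘(ℝ, E) I ω (fun v : E ↦ expMap cov x (show TangentSpace I x from v))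
      {v : E | (show TangentSpace I x from v) ∈ expDomain cov x} :=
  (contMDiffOn_expMap_totalSpace_analytic (cov := cov) hcov).comp
    (contMDiff_tangentTotalSpaceMk_omega (I := I) (M := M) x).contMDiffOn (fun _ hv ↦ hv.2)

/-- **On a geodesically complete locally `C^ω` connection `exp_x : T_x M → M` is `C^ω`**
(`𝓔_x = T_x M`, `expDomain_eq_univ`). [cite: LeeRiemannianManifolds2018, Prop. 5.19 (a) and p. 131] -/
theorem contMDiff_expMap_of_isGeodesicallyComplete_analytic (hcov : cov.IsLocallyContMDiff ω)
    (hc : IsGeodesicallyComplete cov) (x : M) :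
    ContMDiff 𝓘(ℝ, E) I ω (fun v : E ↦ expMap cov x (show TangentSpace I x from v)) := by
  have h := contMDiffOn_expMap_analytic (cov := cov) hcov x
  have hu : {v : E | (show TangentSpace I x from v) ∈ expDomain cov x} = univ :=
    eq_univ_of_forall fun v ↦ by
      show (show TangentSpace I x from v) ∈ expDomain cov x
      rw [expDomain_eq_univ (cov := cov) hc x]
      exact mem_univ _
  rw [hu] at h
  exact contMDiffOn_univ.1 h

end Global

/-! ### The Riemannian exponential map of a real-analytic metric -/

section Riemannian

open Literature.Geometry.Lorentzian.PseudoRiemannianMetric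

variable [CompleteSpace E] [T2Space M] [BoundarylessManifold I M]
  (g : PseudoRiemannianMetric I ω E (TangentSpace I : M → Type _)) [g.HasLeviCivita]
  [CovariantDerivative.ContMDiffCovariantDerivative g.leviCivita 1]

/-- **`exp_p : T_pM → M` is `C^ω` for a real-analytic metric with complete Levi-Civita connection
on a real-analytic manifold** (Lee 2018, Prop. 5.19 (a), analytic case; Buchner 1977, p. 119:
"Since `M` is analytic the geodesics depend analytically on their initial conditions"): the
Levi-Civita connection of a `C^ω` metric is locally `C^ω` (`isLocallyContMDiff_leviCivita_omega`,
Gallot–Hulin–Lafontaine 2004, Prop. 2.54) and `contMDiff_expMap_of_isGeodesicallyComplete_analytic`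
applies. [cite: Buchner1977Simplicial, p. 119] -/
theorem contMDiff_riemannianExpMap_omega (hc : IsGeodesicallyComplete g.leviCivita) (p : M) :
    ContMDiff 𝓘(ℝ, E) I ω (fun w : E ↦ riemannianExpMap g p (show TangentSpace I p from w)) :=
  contMDiff_expMap_of_isGeodesicallyComplete_analytic (cov := g.leviCivita)
    g.isLocallyContMDiff_leviCivita_omega hc p

/-- **The full exponential map `(p, v) ↦ exp_p(v)` of a real-analytic metric is `C^ω` on its
domain `𝓔 ⊆ TM`** (Lee 2018, Prop. 5.19 (a), analytic case) — the form needed for the analytic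
structure of Milnor's broken-geodesic approximation in Buchner 1977, p. 119.
[cite: Buchner1977Simplicial, p. 119] -/
theorem contMDiffOn_riemannianExpMap_totalSpace_omega :
    ContMDiffOn I.tangent I ω (fun q : TangentBundle I M ↦ riemannianExpMap g q.proj q.2)
      {q : TangentBundle I M | (1 : ℝ) ∈ maximalGeodesicDomain g.leviCivita q.proj q.2} :=
  contMDiffOn_expMap_totalSpace_analytic (cov := g.leviCivita) g.isLocallyContMDiff_leviCivita_omega

end Riemannian

end Literature.Geometry.Riemannian

end
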